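import Summits.FinalStateConjecture.FinalStateConjecture.Theorems.RenormalisedDriftDriftCaptureLorentzProjection
import HarnessLib

/-!
# Crux `DriftCapture` (stmt-FinalStateConjecture-17391), stub `stub_glueForwardChain`:
# `C¹` near-`η`-isometries with small oscillation of the differential are `C⁰`/`C¹`-close to an
# affine Poincaré map on convex cells

This file is a BRICK for the registered stub `stub_glueForwardChain` of crux
stmt-FinalStateConjecture-17391 (`DriftCapture`): the `C⁰`/`C¹` part of SEAM RIGIDITY (G1). The
gluing step compares two approximately flat late charts on a fat convex overlap `C`; their transition
map `T` has a differential `T' x` which is, pointwise, a near-`η`-isometry of bounded operator norm,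
and whose oscillation on `C` is small (the latter is supplied by a Christoffel transport identity from
the `C¹`-closeness of the two pulled-back metrics, a separate brick). From these two inputs we get ONE
Lorentz transformation `Λ ∈ O(1,3)` with `‖T' x − Λ‖ ≤ ε` on all of `C` and
`‖(T x − T x₀) − Λ (x − x₀)‖ ≤ ε ‖x − x₀‖` on `C`, i.e. `T` is `C¹`- and `C⁰`-close on the cell to the
affine Poincaré map `x ↦ T x₀ + Λ (x − x₀)`:

* `affine_near_of_norm_sub_le_of_oscillation_le` — the elementary calculus step on a convex subset of
  any real normed space: `‖T' x₀ − φ‖ ≤ ε − δ` and oscillation `≤ δ` give `‖T' x − φ‖ ≤ ε` on `C`,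
  and then the mean value inequality (`Convex.norm_image_sub_le_of_norm_hasFDerivWithin_le'`) gives
  `‖(T x − T x₀) − φ (x − x₀)‖ ≤ ε ‖x − x₀‖`;
* `exists_lorentzGroup_affine_near_of_small_defect` — the registered sub-goal (G1′): combine the
  landed finite-dimensional core `exists_lorentzGroup_near_of_small_defect` (p168312) at the base
  point `x₀` with the calculus step;
* `exists_lorentzGroup_affine_near_of_fderiv2_le` — the same with the oscillation hypothesis
  replaced by a bound `κ` on a second derivative `T''` within `C` and a diameter bound `dC` of the
  cell, under the smallness condition `κ · dC ≤ δ` (mean value inequality once more);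
* `exists_lorentzGroup_fix_affine_near_of_small_defect` — the time-axis-stabiliser form (G1K) for
  the Kerr seams, from the landed `exists_lorentzGroup_fix_near_of_small_defect`: if moreover
  `‖T' x₀ ∂₀ − ∂₀‖ ≤ δ`, then `Λ` can be taken with `Λ ∂₀ = ∂₀`.

Closeness to ONE affine map on an ENTIRE long slab is false in general (F. John's rotation-and-strain
drift: the rotation part of a map with uniformly small strain may drift logarithmically with the
aspect ratio), which is why the statement is per convex cell with the oscillation as an explicit
input. No rate in `δ` is claimed; the gluing stub only consumes the qualitative modulus.

References (context only; the proofs are Mathlib's mean value inequality plus p168312):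
F. John, *Rotation and strain*, Comm. Pure Appl. Math. 14 (1961), 391–413; Yu. G. Reshetnyak,
*Stability theorems in geometry and analysis* (1982; Engl. transl. Kluwer 1994), Ch. 3 (stability in
Liouville's theorem, closeness of near-isometries to motions); O'Neill 1983, Ch. 9, pp. 233–236
(the Lorentz group). [folklore]
-/

-- the doubled `FinalStateConjecture.FinalStateConjecture` path component trips dupNamespace
set_option linter.dupNamespace false

noncomputable section

namespace Summit.FinalStateConjecture.FinalStateConjecture.Theorems.RenormalisedDrift.DriftCapture

open Set Filter Topology Metric
open Literature.Geometry.Lorentzian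

/-- **Calculus step (mean value inequality on a convex set).** Let `C` be a convex subset of a real
normed space, `T` differentiable within `C` with derivative `T' x` at every `x ∈ C`, and suppose the
oscillation of `T'` on `C` is at most `δ`. If a fixed continuous linear map `φ` satisfies
`‖T' x₀ − φ‖ ≤ ε − δ` at a base point `x₀ ∈ C`, then `‖T' x − φ‖ ≤ ε` on `C` (triangle inequality)
and `‖(T x − T x₀) − φ (x − x₀)‖ ≤ ε ‖x − x₀‖` on `C`
(`Convex.norm_image_sub_le_of_norm_hasFDerivWithin_le'`). F. John 1961 (rotation and strain), §1,
for the Euclidean prototype. [folklore] -/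
theorem affine_near_of_norm_sub_le_of_oscillation_le {E F : Type*} [NormedAddCommGroup E]
    [NormedSpace ℝ E] [NormedAddCommGroup F] [NormedSpace ℝ F] {C : Set E} (hC : Convex ℝ C)
    {T : E → F} {T' : E → E →L[ℝ] F} (hT : ∀ x ∈ C, HasFDerivWithinAt T (T' x) C x) {δ ε : ℝ}
    (hosc : ∀ x ∈ C, ∀ y ∈ C, ‖T' x - T' y‖ ≤ δ) {x₀ : E} (hx₀ : x₀ ∈ C) {φ : E →L[ℝ] F}
    (hφ : ‖T' x₀ - φ‖ ≤ ε - δ) :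
    (∀ x ∈ C, ‖T' x - φ‖ ≤ ε) ∧ ∀ x ∈ C, ‖(T x - T x₀) - φ (x - x₀)‖ ≤ ε * ‖x - x₀‖ := by
  have hC1 : ∀ x ∈ C, ‖T' x - φ‖ ≤ ε := fun x hx ↦
    calc ‖T' x - φ‖ ≤ ‖T' x - T' x₀‖ + ‖T' x₀ - φ‖ := norm_sub_le_norm_sub_add_norm_sub _ _ _
      _ ≤ δ + (ε - δ) := add_le_add (hosc x hx x₀ hx₀) hφ
      _ = ε := by ring
  exact ⟨hC1, fun x hx ↦ hC.norm_image_sub_le_of_norm_hasFDerivWithin_le' hT hC1 hx₀ hx⟩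

/-- **Affine approximation of `C¹` near-`η`-isometries on convex sets (G1′, the registered
sub-goal `exists_lorentzGroup_affine_near_of_small_defect` for `stub_glueForwardChain`).** For every
norm bound `Lb` and every `ε > 0` there is `δ > 0` such that: for every convex `C ⊆ E4` and every
`T : E4 → E4` with derivative `T' x` within `C` at each `x ∈ C`, if `‖T' x‖ ≤ Lb`, the `η`-defect of
`T' x` is at most `δ‖v‖‖w‖`, and the oscillation of `T'` on `C` is at most `δ`, then for every base
point `x₀ ∈ C` there is ONE Lorentz transformation `Λ` with `‖T' x − Λ‖ ≤ ε` on `C` and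
`‖(T x − T x₀) − Λ (x − x₀)‖ ≤ ε‖x − x₀‖` on `C`. Proof: `δ := min δ₁ (ε/2)` with `δ₁` from the
landed `exists_lorentzGroup_near_of_small_defect Lb (ε/2)` applied to `T' x₀`, then
`affine_near_of_norm_sub_le_of_oscillation_le`. F. John 1961; Reshetnyak, *Stability theorems in
geometry and analysis*, Ch. 3. [folklore] -/
theorem exists_lorentzGroup_affine_near_of_small_defect : ∀ (Lb ε : ℝ), 0 < ε → ∃ δ : ℝ, 0 < δ ∧ ∀ (C : Set E4), Convex ℝ C → ∀ (T : E4 → E4) (T' : E4 → (E4 →L[ℝ] E4)), (∀ x ∈ C, HasFDerivWithinAt T (T' x) C x) → (∀ x ∈ C, ‖T' x‖ ≤ Lb) → (∀ x ∈ C, ∀ v w : E4, |Minkowski.bilin (T' x v) (T' x w) - Minkowski.bilin v w| ≤ δ * ‖v‖ * ‖w‖) → (∀ x ∈ C, ∀ y ∈ C, ‖T' x - T' y‖ ≤ δ) → ∀ x₀ ∈ C, ∃ Λ : lorentzGroup, (∀ x ∈ C, ‖T' x - ((Λ : E4 ≃L[ℝ] E4) : E4 →L[ℝ] E4)‖ ≤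 ε) ∧ ∀ x ∈ C, ‖(T x - T x₀) - (Λ : E4 ≃L[ℝ] E4) (x - x₀)‖ ≤ ε * ‖x - x₀‖ := by
  intro Lb ε hε
  obtain ⟨δ₁, hδ₁, H⟩ := exists_lorentzGroup_near_of_small_defect Lb (ε / 2) (half_pos hε)
  refine ⟨min δ₁ (ε / 2), lt_min hδ₁ (half_pos hε), ?_⟩
  intro C hC T T' hT hLb hdef hosc x₀ hx₀
  obtain ⟨Λ, hΛ⟩ := H (T' x₀) (hLb x₀ hx₀) fun v w ↦ (hdef x₀ hx₀ v w).trans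
    (mul_le_mul_of_nonneg_right (mul_le_mul_of_nonneg_right (min_le_left _ _) (norm_nonneg _))
      (norm_nonneg _))
  have hosc' : ∀ x ∈ C, ∀ y ∈ C, ‖T' x - T' y‖ ≤ ε / 2 := fun x hx y hy ↦
    (hosc x hx y hy).trans (min_le_right _ _)
  have hφ : ‖T' x₀ - ((Λ : E4 ≃L[ℝ] E4) : E4 →L[ℝ] E4)‖ ≤ ε - ε / 2 := hΛ.trans_eq (by ring)
  obtain ⟨h1, h0⟩ := affine_near_of_norm_sub_le_of_oscillation_le hC hT hosc' hx₀ hφ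
  exact ⟨Λ, h1, fun x hx ↦ by simpa only [ContinuousLinearEquiv.coe_coe] using h0 x hx⟩

/-- **Second-derivative form of (G1′).** Same conclusion with the oscillation hypothesis REPLACED by
a bound on a second derivative within the cell and a diameter bound: if moreover `T'` has derivative
`T'' x` within `C` at each `x ∈ C` with `‖T'' x‖ ≤ κ`, all points of `C` are within distance `dC`
of each other, and `κ · dC ≤ δ`, then the oscillation of `T'` on `C` is at most `κ · dC ≤ δ` by the
mean value inequality (`Convex.norm_image_sub_le_of_norm_hasFDerivWithin_le`), and
`exists_lorentzGroup_affine_near_of_small_defect` applies with the same `δ`. (The bound on `T''` is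
what the Christoffel transport identity delivers from `C¹`-closeness of the two pulled-back metrics.)
F. John 1961; Reshetnyak, *Stability theorems in geometry and analysis*, Ch. 3. [folklore] -/
theorem exists_lorentzGroup_affine_near_of_fderiv2_le : ∀ (Lb ε : ℝ), 0 < ε → ∃ δ : ℝ, 0 < δ ∧ ∀ (C : Set E4), Convex ℝ C → ∀ (T : E4 → E4) (T' : E4 → (E4 →L[ℝ] E4)) (T'' : E4 → (E4 →L[ℝ] E4 →L[ℝ] E4)) (κ dC : ℝ), (∀ x ∈ C, HasFDerivWithinAt T (T' x) C x) → (∀ x ∈ C, HasFDerivWithinAt T' (T'' x) C x) → (∀ x ∈ C, ‖T' x‖ ≤ Lb) → (∀ x ∈ C, ‖T'' x‖ ≤ κ) → (∀ x ∈ C, ∀ y ∈ C, ‖x - y‖ ≤ dC) → κ * dC ≤ δ → (∀ x ∈ C, ∀ v w : E4, |Minkowski.bilin (T' x v) (T' x w) - Minkowski.bilin v w| ≤ δ * ‖v‖ * ‖w‖) → ∀ x₀ ∈ C, ∃ Λ : lorentzGroup, (∀ x ∈ C, ‖T' x - ((Λ : E4 ≃L[ℝ] E4) : E4 →L[ℝ]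 E4)‖ ≤ ε) ∧ ∀ x ∈ C, ‖(T x - T x₀) - (Λ : E4 ≃L[ℝ] E4) (x - x₀)‖ ≤ ε * ‖x - x₀‖ := by
  intro Lb ε hε
  obtain ⟨δ, hδ, H⟩ := exists_lorentzGroup_affine_near_of_small_defect Lb ε hε
  refine ⟨δ, hδ, ?_⟩
  intro C hC T T' T'' κ dC hT hT' hLb hκ hdC hκdC hdef x₀ hx₀
  refine H C hC T T' hT hLb hdef (fun x hx y hy ↦ ?_) x₀ hx₀
  have hκ0 : 0 ≤ κ := (norm_nonneg (T'' x)).trans (hκ x hx)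
  calc ‖T' x - T' y‖ ≤ κ * ‖x - y‖ := hC.norm_image_sub_le_of_norm_hasFDerivWithin_le hT' hκ hy hx
    _ ≤ κ * dC := mul_le_mul_of_nonneg_left (hdC x hx y hy) hκ0
    _ ≤ δ := hκdC

/-- **Time-axis-stabiliser form (G1K, for the Kerr seams).** For every norm bound `Lb` and every
`ε > 0` there is `δ > 0` such that: for every convex `C ⊆ E4`, every `T : E4 → E4` with derivative
`T' x` within `C` at each `x ∈ C`, `‖T' x‖ ≤ Lb`, `η`-defect of `T' x` at most `δ‖v‖‖w‖`,
oscillation of `T'` on `C` at most `δ`, and every base point `x₀ ∈ C` at which MOREOVER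
`‖T' x₀ ∂₀ − ∂₀‖ ≤ δ`, there is a Lorentz transformation `Λ` FIXING the time axis, `Λ ∂₀ = ∂₀`, with
`‖T' x − Λ‖ ≤ ε` on `C` and `‖(T x − T x₀) − Λ (x − x₀)‖ ≤ ε‖x − x₀‖` on `C`. Proof: as for
`exists_lorentzGroup_affine_near_of_small_defect`, from the landed stabiliser core
`exists_lorentzGroup_fix_near_of_small_defect`. F. John 1961; O'Neill 1983, Ch. 9, pp. 233–236.
[folklore] -/
theorem exists_lorentzGroup_fix_affine_near_of_small_defect : ∀ (Lb ε : ℝ), 0 < ε → ∃ δ : ℝ, 0 < δ ∧ ∀ (C : Set E4), Convex ℝ C → ∀ (T : E4 → E4) (T' : E4 → (E4 →L[ℝ] E4)), (∀ x ∈ C, HasFDerivWithinAt T (T' x) C x) → (∀ x ∈ C, ‖T' x‖ ≤ Lb) → (∀ x ∈ C, ∀ v w : E4, |Minkowski.bilin (T' x v) (T' x w) - Minkowski.bilin v w| ≤ δ * ‖v‖ * ‖w‖) → (∀ x ∈ C, ∀ y ∈ C, ‖T' x - T' y‖ ≤ δ) → ∀ x₀ ∈ C, ‖T' x₀ (E4.basisVector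 0) - E4.basisVector 0‖ ≤ δ → ∃ Λ : lorentzGroup, (Λ : E4 ≃L[ℝ] E4) (E4.basisVector 0) = E4.basisVector 0 ∧ (∀ x ∈ C, ‖T' x - ((Λ : E4 ≃L[ℝ] E4) : E4 →L[ℝ] E4)‖ ≤ ε) ∧ ∀ x ∈ C, ‖(T x - T x₀) - (Λ : E4 ≃L[ℝ] E4) (x - x₀)‖ ≤ ε * ‖x - x₀‖ := by
  intro Lb ε hε
  obtain ⟨δ₁, hδ₁, H⟩ := exists_lorentzGroup_fix_near_of_small_defect Lb (ε / 2) (half_pos hε)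
  refine ⟨min δ₁ (ε / 2), lt_min hδ₁ (half_pos hε), ?_⟩
  intro C hC T T' hT hLb hdef hosc x₀ hx₀ h0
  obtain ⟨Λ, hΛ0, hΛ⟩ := H (T' x₀) (hLb x₀ hx₀) (fun v w ↦ (hdef x₀ hx₀ v w).trans
    (mul_le_mul_of_nonneg_right (mul_le_mul_of_nonneg_right (min_le_left _ _) (norm_nonneg _))
      (norm_nonneg _))) (h0.trans (min_le_left _ _))
  have hosc' : ∀ x ∈ C, ∀ y ∈ C, ‖T' x - T' y‖ ≤ ε / 2 := fun x hx y hy ↦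
    (hosc x hx y hy).trans (min_le_right _ _)
  have hφ : ‖T' x₀ - ((Λ : E4 ≃L[ℝ] E4) : E4 →L[ℝ] E4)‖ ≤ ε - ε / 2 := hΛ.trans_eq (by ring)
  obtain ⟨h1, h0'⟩ := affine_near_of_norm_sub_le_of_oscillation_le hC hT hosc' hx₀ hφ
  exact ⟨Λ, hΛ0, h1, fun x hx ↦ by simpa only [ContinuousLinearEquiv.coe_coe] using h0' x hx⟩

end Summit.FinalStateConjecture.FinalStateConjecture.Theorems.RenormalisedDrift.DriftCapture

end
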